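import Literature.Barriers.PneNP.FeasibleInterpolation
import HarnessLib

/-!
# The RSA pair in Bezout form: semantic lemmas for certificate-based discharges of Cor. 10

Companion of `FeasibleInterpolationTransfer.lean` (which reduces the named fact
`Literature.Barriers.PneNP.RSAPairDisjointnessEFProofs` — the proof-complexity half of
Krajíček–Pudlák 1998, Cor. 10 — to ONE sound rule list with a polynomial size bound). A
discharge builds, for each length `m`, two constraint systems ("certificates") over the `3m`
common atoms of `(n, e, y)`: one satisfied on the members of `A₀ = rsaPair 0`, one on the
members of `A₁ = rsaPair 1`, together with a polynomial-size extended Frege refutation of their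
conjunction. This file records the number theory behind the natural ASYMMETRIC choice of
certificates — coprimality `(e, r) = 1` entered only through a checked Bezout identity
`e·u = r·v + 1` on the `A₀` side, the `A₁` side keeping just its defining witnesses `x₁, d` —
namely the covering property of the Bezout-form certificate (`exists_bezout_of_mem_rsaPair_zero`,
with `m`-bit bounds on `u, v, r`) and the disjointness it must mirror
(`eq_of_bezout_certificates`, `bezout_certificates_parity_clash`: the algebra of the printed
proof of Theorem 1, `rsaPair_decode`).

## Sources

* [KrajicekPudlak1998] J. Krajíček, P. Pudlák, *Some consequences of cryptographical
  conjectures for `S¹₂` and `EF`*, Inform. and Comput. 140 (1998) 82–94: §1, Thm. 1 and its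
  proof (preprint pp. 3–4); proof of Cor. 10 (preprint pp. 10–11).
-/

namespace Literature.Barriers.PneNP

/-! ### The covering pair in Bezout form

A propositional certificate cannot run Euclid's algorithm cheaply, but it can CHECK a Bezout
identity `e · u = r · v + 1` by one multiplication on each side; and the proof of Theorem 1
only ever uses `(e, r) = 1` through such an identity (`rsaPair_decode`). The lemmas below
record, at the level of numbers, the two facts a discharge of `RSAPairDisjointnessEFProofs`
along these lines needs for its covering properties and mirrors in its refutation: every member
of `A₀` has a certificate `(x₀, u, v, r)` in Bezout form with `m`-bit entries
(`exists_bezout_of_mem_rsaPair_zero`; for `A₁` the defining witnesses `(x₁, d)` are used as they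
are), and two such certificates for the same `(n, e, y)` decode the same `x`
(`eq_of_bezout_certificates`, whose proof is the chain `yᵘ ≡ x₁^{eu} = (x₁ʳ)ᵛ·x₁ ≡ x₁` with
`x₁ʳ ≡ (yᵈ)ʳ = (yʳ)ᵈ ≡ 1` of `rsaPair_decode`), so that the parities clash
(`bezout_certificates_parity_clash`). -/

/-- **Members of `A₀` in Bezout form.** If `(n, e, y) ∈ A₀` then there are `x < n` even,
`r < n`, `u ≤ max r 1` and `v ≤ e` with `e·u = r·v + 1`, `yʳ ≡ 1` and `yᵘ ≡ x (mod n)`: for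
`r ≥ 2` take the inverse `u < r` of `e` modulo `r`; for `r = 1` take `u = 1, v = e - 1`
(`e = 0` is impossible: it forces `y ≡ 1`, hence `x ≡ 1`, contradicting `x` even, `x < n`);
for `r = 0`, `(e, 0) = 1` forces `e = 1` and `u = 1, v = 0`. In each case `yᵘ ≡ x` is
`rsaPair_decode`. [cite: KrajicekPudlak1998, proof of Thm. 1 (preprint pp. 3–4)] -/
theorem exists_bezout_of_mem_rsaPair_zero {n e y : ℕ} (h : (n, e, y) ∈ rsaPair 0) :
    ∃ x u v r : ℕ, x < n ∧ x % 2 = 0 ∧ r < n ∧ u ≤ max r 1 ∧ v ≤ e ∧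
      e * u = r * v + 1 ∧ y ^ r ≡ 1 [MOD n] ∧ y ^ u ≡ x [MOD n] := by
  rw [mem_rsaPair_iff] at h
  obtain ⟨x, d, r, hx, -, hr, hpar, he, hd, hr1, hcop⟩ := h
  rcases Nat.lt_or_ge r 2 with hr2 | hr2
  · interval_cases r
    · -- `r = 0`: `e = 1`
      have he1 : e = 1 := by
        have h := hcop
        rw [Nat.Coprime, Nat.gcd_zero_right] at h
        exact h
      subst he1
      exact ⟨x, 1, 0, 0, hx, hpar, hr, by simp, by simp, by simp, hr1,
        rsaPair_decode he hd hr1 (m := 1) (q := 0) (by norm_num)⟩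
    · -- `r = 1`: `e ≠ 0`, `u = 1`, `v = e - 1`
      have he0 : e ≠ 0 := by
        rintro rfl
        -- `y ≡ 1`, so `x ≡ y ^ d ≡ 1`; with `x` even and `x < n` this is impossible
        have hy : y ≡ 1 [MOD n] := by simpa using he.symm
        have hx1 : x ≡ 1 [MOD n] := by
          calc x ≡ y ^ d [MOD n] := hd.symm
            _ ≡ 1 ^ d [MOD n] := hy.pow d
            _ = 1 := one_pow d
        rcases Nat.lt_or_ge n 2 with hn | hn
        · omega
        · have := Nat.ModEq.eq_of_lt_of_lt hx1 hx hn
          omega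
      refine ⟨x, 1, e - 1, 1, hx, hpar, hr, by simp, by omega, by omega, hr1,
        rsaPair_decode he hd hr1 (m := 1) (q := e - 1) (by omega)⟩
  · -- `r ≥ 2`: the inverse of `e` modulo `r`
    obtain ⟨u, hur, hu⟩ := Nat.exists_mul_mod_eq_one_of_coprime hcop hr2
    have hdecomp : e * u = r * (e * u / r) + 1 := by
      have := Nat.div_add_mod (e * u) r
      rw [hu] at this
      exact this.symm
    refine ⟨x, u, e * u / r, r, hx, hpar, hr, ?_, ?_, hdecomp, hr1, rsaPair_decode he hd hr1 hdecomp⟩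
    · exact (Nat.le_of_lt hur).trans (le_max_left _ _)
    · exact Nat.div_le_of_le_mul (by rw [Nat.mul_comm r e]; exact Nat.mul_le_mul_left e hur.le)

/-- **Two certificates decode the same plaintext.** If `e·u = r·v + 1`, `yʳ ≡ 1`, `yᵘ ≡ x₀`
(a Bezout-form certificate) and `x₁ᵉ ≡ y`, `yᵈ ≡ x₁` (the defining witnesses of `A₁` without
its own `r`), all modulo `n`, with `x₀, x₁ < n`, then `x₀ = x₁`: by `rsaPair_decode`,
`yᵘ ≡ x₁`. This is the algebra of the proof of Theorem 1 arranged so that only ONE side needs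
the coprimality data. [cite: KrajicekPudlak1998, proof of Thm. 1 (preprint pp. 3–4)] -/
theorem eq_of_bezout_certificates {n e y x₀ u v r x₁ d : ℕ} (hx₀ : x₀ < n)
    (huv : e * u = r * v + 1) (hr : y ^ r ≡ 1 [MOD n]) (hu : y ^ u ≡ x₀ [MOD n])
    (hx₁ : x₁ < n) (he : x₁ ^ e ≡ y [MOD n]) (hd : y ^ d ≡ x₁ [MOD n]) : x₀ = x₁ :=
  Nat.ModEq.eq_of_lt_of_lt (hu.symm.trans (rsaPair_decode he hd hr huv)) hx₀ hx₁

/-- **The parity clash.** A Bezout-form certificate with `x₀` even and defining witnesses of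
`A₁` with `x₁` odd cannot coexist for the same `(n, e, y)`. [cite: KrajicekPudlak1998, proof of Thm. 1 (preprint pp. 3–4)] -/
theorem bezout_certificates_parity_clash {n e y x₀ u v r x₁ d : ℕ} (hx₀ : x₀ < n)
    (hpar₀ : x₀ % 2 = 0) (huv : e * u = r * v + 1) (hr : y ^ r ≡ 1 [MOD n])
    (hu : y ^ u ≡ x₀ [MOD n]) (hx₁ : x₁ < n) (hpar₁ : x₁ % 2 = 1) (he : x₁ ^ e ≡ y [MOD n])
    (hd : y ^ d ≡ x₁ [MOD n]) : False := by
  have := eq_of_bezout_certificates hx₀ huv hr hu hx₁ he hd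
  omega

end Literature.Barriers.PneNP
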